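import Mathlib
import Literature.MathematicalPhysics.MHD.GradShafranov
import HarnessLib

/-!
# Exact polynomial (Solov'ev-type) solutions of the Grad–Shafranov equation (as printed, proved)

With Solov'ev profiles (`μ₀ dp/dψ = -C`, `F dF/dψ = -A`) the Grad–Shafranov equation is the linear
equation `Δ*ψ = A + C R²` (`GradShafranov.IsSolovevSolutionOn`, Freidberg 2014 eq. (6.149)).
This file types three PRINTED pure-polynomial solution families and PROVES that each solves its
equation (every theorem below is a finite calculus identity; nothing is a named fact):

* `psiPCF d₁ d₂ d₃ (R, Z) = R⁴/8 + d₁ + d₂ R² + d₃ (R⁴ - 4R²Z²)` with `Δ*Ψ = R²` (`A = 0`, `C = 1`,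
  `R₀ = 1`), the benchmark solution of Pataki–Cerfon–Freidberg, J. Comput. Phys. 243 (2013) §6.1
  (arXiv:1210.2113), with its three-point shape fit `Ψ(1±ε,0) = 0`, `Ψ(1-δε, κε) = 0` (ibid.);
  proved consequences used by LADDER-GRIDFUSION F1.a: midplane factorisation, the magnetic axis at
  `R_a² = 1 + ε²`, flux surfaces are graphs `Z² = G(R)`, the on-axis second derivatives;
* `psiJardin c₀ c₁ c₂ R₀ (R, Z) = ½(c₂R₀² + c₀R²)Z² + ⅛(c₁ - c₀)(R² - R₀²)²` with
  `Δ*Ψ = c₁R² + c₂R₀²` — Jardin, *Computational Methods in Plasma Physics* (CRC 2010) §4.4.2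
  eq. (4.38) p.104 («Shafranov–Solov'ev solution»), and its tokamak normalisation eq. (4.39)
  `Ψ = (B₀/(2R₀²κ₀q₀))[R²Z² + (κ₀²/4)(R² - R₀²)²]`, `p(Ψ) = (B₀(κ₀²+1)/(μ₀R₀²κ₀q₀))(Ψ_B - Ψ)`,
  `g = R₀B₀`, for which we PROVE the full Grad–Shafranov equation (6.15) and that the on-axis safety
  factor (Freidberg (6.42)) equals the parameter `q₀` and the on-axis elongation² equals `κ₀²`;
* the exact (cubic-free) case of Solov'ev's 1968 configuration as printed by Xu–Fitzpatrick,
  Nucl. Fusion 59 (2019) 064002 §2 eq. (4) (arXiv:1811.04443), incl. their §3 «first case».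

PROVENANCE NOTE (three columns): Jardin prints the profile of (4.38) as `dp/dΨ = -c₁` while his
Grad–Shafranov equation (4.8) carries `μ₀`; the identity proved here is the unambiguous
`Δ*Ψ = c₁R² + c₂R₀²`, i.e. `c₁` is the constant `-μ₀ dp/dΨ` (the tokamak triple (4.39) is
self-consistent with `μ₀` and is proved as such). Xu–Fitzpatrick's eq. (4) is Solov'ev's THIRD-ORDER
expansion; it solves `Δ*ψ = a r² + b R₀²` exactly iff the cubic term vanishes (`b = (1 - C)A`), which
is the only case typed. Locators read on the page by the typer (gridfusion-model-5, 2026-08-26):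
PCF2013 §6.1 [corpus arXiv:1210.2113 chunk p0012]; Jardin §4.4.2 [galaxy panama:478966162915417
c271000–280000]; Xu–Fitzpatrick §2–3 [corpus arXiv:1811.04443 p0004].
Design: curried `ψ : ℝ → ℝ → ℝ` and the operator/derivative vocabulary of `GradShafranov.lean`;
private calculus helpers compute `Δ*` of an even sextic in `R` with `Z`-dependent coefficients.
NOT here: the logarithmic Cerfon–Freidberg basis (separate file), q off axis (quadrature), stability.
-/

noncomputable section

namespace Literature.MathematicalPhysics.MHD.Solovev

open GradShafranov

/-! ## Calculus helpers -/

/-- Derivative of the even sextic `a + b r² + c r⁴ + e r⁶`. [folklore] -/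
private theorem hasDerivAt_evenSextic (a b c e r : ℝ) :
    HasDerivAt (fun r => a + b * r ^ 2 + c * r ^ 4 + e * r ^ 6)
      (2 * b * r + 4 * c * r ^ 3 + 6 * e * r ^ 5) r := by
  have h := (((hasDerivAt_const r a).fun_add ((hasDerivAt_pow 2 r).const_mul b)).fun_add
    ((hasDerivAt_pow 4 r).const_mul c)).fun_add ((hasDerivAt_pow 6 r).const_mul e)
  exact h.congr_deriv (by norm_num; ring)

/-- Derivative of the odd quintic `2b z + 4c z³ + 6e z⁵`. [folklore] -/
private theorem hasDerivAt_oddQuintic (b c e z : ℝ) :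
    HasDerivAt (fun z => 2 * b * z + 4 * c * z ^ 3 + 6 * e * z ^ 5)
      (2 * b + 12 * c * z ^ 2 + 30 * e * z ^ 4) z := by
  have h := (((hasDerivAt_id' z).const_mul (2 * b)).fun_add
    ((hasDerivAt_pow 3 z).const_mul (4 * c))).fun_add ((hasDerivAt_pow 5 z).const_mul (6 * e))
  exact h.congr_deriv (by norm_num; ring)

/-- `∂ψ/∂R` of an even sextic in `R` (coefficients may depend on the frozen `Z`). [folklore] -/
private theorem dR_evenSextic {ψ : ℝ → ℝ → ℝ} {Z a b c e : ℝ}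
    (hψ : ∀ r, ψ r Z = a + b * r ^ 2 + c * r ^ 4 + e * r ^ 6) (R : ℝ) :
    dR ψ R Z = 2 * b * R + 4 * c * R ^ 3 + 6 * e * R ^ 5 := by
  unfold dR
  rw [show (fun r => ψ r Z) = fun r => a + b * r ^ 2 + c * r ^ 4 + e * r ^ 6 from funext hψ]
  exact (hasDerivAt_evenSextic a b c e R).deriv

/-- `∂ψ/∂Z` of an even sextic in `Z` (coefficients may depend on the frozen `R`). [folklore] -/
private theorem dZ_evenSextic {ψ : ℝ → ℝ → ℝ} {R a b c e : ℝ}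
    (hψ : ∀ z, ψ R z = a + b * z ^ 2 + c * z ^ 4 + e * z ^ 6) (Z : ℝ) :
    dZ ψ R Z = 2 * b * Z + 4 * c * Z ^ 3 + 6 * e * Z ^ 5 := by
  unfold dZ
  rw [show ψ R = fun z => a + b * z ^ 2 + c * z ^ 4 + e * z ^ 6 from funext hψ]
  exact (hasDerivAt_evenSextic a b c e Z).deriv

/-- `∂²ψ/∂R²` of an even sextic in `R`. [folklore] -/
private theorem dRR_evenSextic {ψ : ℝ → ℝ → ℝ} {Z a b c e : ℝ}
    (hψ : ∀ r, ψ r Z = a + b * r ^ 2 + c * r ^ 4 + e * r ^ 6) (R : ℝ) :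
    dRR ψ R Z = 2 * b + 12 * c * R ^ 2 + 30 * e * R ^ 4 := by
  unfold dRR
  rw [show (fun r => ψ r Z) = fun r => a + b * r ^ 2 + c * r ^ 4 + e * r ^ 6 from funext hψ,
    show (2 : ℕ) = 1 + 1 from rfl, iteratedDeriv_succ, iteratedDeriv_one,
    show deriv (fun r => a + b * r ^ 2 + c * r ^ 4 + e * r ^ 6)
        = fun r => 2 * b * r + 4 * c * r ^ 3 + 6 * e * r ^ 5
      from funext fun r => (hasDerivAt_evenSextic a b c e r).deriv]
  exact (hasDerivAt_oddQuintic b c e R).deriv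

/-- `∂²ψ/∂Z²` of an even sextic in `Z`. [folklore] -/
private theorem dZZ_evenSextic {ψ : ℝ → ℝ → ℝ} {R a b c e : ℝ}
    (hψ : ∀ z, ψ R z = a + b * z ^ 2 + c * z ^ 4 + e * z ^ 6) (Z : ℝ) :
    dZZ ψ R Z = 2 * b + 12 * c * Z ^ 2 + 30 * e * Z ^ 4 := by
  unfold dZZ
  rw [show ψ R = fun z => a + b * z ^ 2 + c * z ^ 4 + e * z ^ 6 from funext hψ,
    show (2 : ℕ) = 1 + 1 from rfl, iteratedDeriv_succ, iteratedDeriv_one,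
    show deriv (fun z => a + b * z ^ 2 + c * z ^ 4 + e * z ^ 6)
        = fun z => 2 * b * z + 4 * c * z ^ 3 + 6 * e * z ^ 5
      from funext fun z => (hasDerivAt_evenSextic a b c e z).deriv]
  exact (hasDerivAt_oddQuintic b c e Z).deriv

/-- Radial part of `Δ*` for an even sextic in `R`: `R ∂_R(R⁻¹ ∂_R ψ) = 8c R² + 24e R⁴` at `R ≠ 0`.
[folklore] -/
private theorem radialPart_evenSextic {ψ : ℝ → ℝ → ℝ} {Z a b c e R : ℝ} (hR : R ≠ 0)
    (hψ : ∀ r, ψ r Z = a + b * r ^ 2 + c * r ^ 4 + e * r ^ 6) :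
    R * deriv (fun r => r⁻¹ * dR ψ r Z) R = 8 * c * R ^ 2 + 24 * e * R ^ 4 := by
  have hfun : (fun r => r⁻¹ * dR ψ r Z) =ᶠ[nhds R]
      fun r => 2 * b + (4 * c) * r ^ 2 + (6 * e) * r ^ 4 + 0 * r ^ 6 := by
    filter_upwards [isOpen_ne.mem_nhds hR] with r hr
    rw [dR_evenSextic hψ r]
    field_simp
    ring
  rw [hfun.deriv_eq, (hasDerivAt_evenSextic (2 * b) (4 * c) (6 * e) 0 R).deriv]
  ring

/-- `Δ*` of `ψ` when `r ↦ ψ(r, Z)` is the even sextic `a + b r² + c r⁴ + e r⁶` and `z ↦ ψ(R, z)` is the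
even sextic `a' + b' z² + c' z⁴ + e' z⁶`: `Δ*ψ(R,Z) = 8cR² + 24eR⁴ + 2b' + 12c'Z² + 30e'Z⁴`
(`R ≠ 0`). [folklore] -/
private theorem gsOperator_evenSextic {ψ : ℝ → ℝ → ℝ} {R Z a b c e a' b' c' e' : ℝ} (hR : R ≠ 0)
    (hR' : ∀ r, ψ r Z = a + b * r ^ 2 + c * r ^ 4 + e * r ^ 6)
    (hZ' : ∀ z, ψ R z = a' + b' * z ^ 2 + c' * z ^ 4 + e' * z ^ 6) :
    gsOperator ψ R Z
      = 8 * c * R ^ 2 + 24 * e * R ^ 4 + (2 * b' + 12 * c' * Z ^ 2 + 30 * e' * Z ^ 4) := by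
  unfold gsOperator
  rw [radialPart_evenSextic hR hR', dZZ_evenSextic hZ' Z]

/-! ## The Pataki–Cerfon–Freidberg polynomial Solov'ev solution (`Δ*Ψ = R²`) -/

/-- The PCF benchmark solution `Ψ(R,Z) = R⁴/8 + d₁ + d₂R² + d₃(R⁴ - 4R²Z²)` of `Δ*Ψ = R²`
(particular solution `R⁴/8` plus three polynomial homogeneous solutions), in units `R₀ = 1`.
[cite: PatakiCerfonFreidberg2013, §6.1 eq. (psi_exact)] -/
def psiPCF (d₁ d₂ d₃ : ℝ) (R Z : ℝ) : ℝ :=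
  R ^ 4 / 8 + d₁ + d₂ * R ^ 2 + d₃ * (R ^ 4 - 4 * R ^ 2 * Z ^ 2)

/-- **PCF's `Ψ_exact` solves `Δ*Ψ = R²` for every `d₁, d₂, d₃`** (at `R ≠ 0`).
[cite: PatakiCerfonFreidberg2013, §6.1] -/
theorem gsOperator_psiPCF (d₁ d₂ d₃ : ℝ) {R : ℝ} (Z : ℝ) (hR : R ≠ 0) :
    gsOperator (psiPCF d₁ d₂ d₃) R Z = R ^ 2 := by
  rw [gsOperator_evenSextic (ψ := psiPCF d₁ d₂ d₃) (a := d₁) (b := d₂ - 4 * d₃ * Z ^ 2)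
    (c := 1 / 8 + d₃) (e := 0) (a' := R ^ 4 / 8 + d₁ + d₂ * R ^ 2 + d₃ * R ^ 4)
    (b' := -(4 * d₃ * R ^ 2)) (c' := 0) (e' := 0) hR (fun r => by unfold psiPCF; ring)
    (fun z => by unfold psiPCF; ring)]
  ring

/-- Hence `psiPCF` is a Solov'ev solution with `A = 0`, `C = 1` on `{R ≠ 0}`
(Freidberg (6.149) normalised as in PCF2013 §6.1). [cite: PatakiCerfonFreidberg2013, §6.1] -/
theorem isSolovevSolutionOn_psiPCF (d₁ d₂ d₃ : ℝ) :
    IsSolovevSolutionOn {x : ℝ × ℝ | x.1 ≠ 0} (psiPCF d₁ d₂ d₃) 0 1 := by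
  intro R Z h
  rw [gsOperator_psiPCF d₁ d₂ d₃ Z h]
  ring

/-- PCF's three-point shape fit determining `(d₁, d₂, d₃)` from inverse aspect ratio `ε`, elongation
`κ`, triangularity `δ`: `Ψ(1+ε, 0) = 0`, `Ψ(1-ε, 0) = 0`, `Ψ(1-δε, κε) = 0` (the printed 3×3 linear
system). [cite: PatakiCerfonFreidberg2013, §6.1 eq. (system)] -/
def IsPCFShapeFit (ε κ δ d₁ d₂ d₃ : ℝ) : Prop :=
  psiPCF d₁ d₂ d₃ (1 + ε) 0 = 0 ∧ psiPCF d₁ d₂ d₃ (1 - ε) 0 = 0 ∧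
    psiPCF d₁ d₂ d₃ (1 - δ * ε) (κ * ε) = 0

/-- `∂Ψ/∂R` of the PCF solution: `R³/2 + 2d₂R + d₃(4R³ - 8RZ²)`. [cite: PatakiCerfonFreidberg2013, §6.1] -/
theorem dR_psiPCF (d₁ d₂ d₃ R Z : ℝ) :
    dR (psiPCF d₁ d₂ d₃) R Z = R ^ 3 / 2 + 2 * d₂ * R + d₃ * (4 * R ^ 3 - 8 * R * Z ^ 2) := by
  rw [dR_evenSextic (ψ := psiPCF d₁ d₂ d₃) (a := d₁) (b := d₂ - 4 * d₃ * Z ^ 2) (c := 1 / 8 + d₃)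
    (e := 0) (fun r => by unfold psiPCF; ring)]
  ring

/-- `∂Ψ/∂Z` of the PCF solution: `-8 d₃ R² Z`. [cite: PatakiCerfonFreidberg2013, §6.1] -/
theorem dZ_psiPCF (d₁ d₂ d₃ R Z : ℝ) : dZ (psiPCF d₁ d₂ d₃) R Z = -(8 * d₃ * R ^ 2 * Z) := by
  rw [dZ_evenSextic (ψ := psiPCF d₁ d₂ d₃) (a := R ^ 4 / 8 + d₁ + d₂ * R ^ 2 + d₃ * R ^ 4)
    (b := -(4 * d₃ * R ^ 2)) (c := 0) (e := 0) (fun z => by unfold psiPCF; ring)]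
  ring

/-- `∂²Ψ/∂R²` of the PCF solution: `3R²/2 + 2d₂ + d₃(12R² - 8Z²)`. [cite: PatakiCerfonFreidberg2013, §6.1] -/
theorem dRR_psiPCF (d₁ d₂ d₃ R Z : ℝ) :
    dRR (psiPCF d₁ d₂ d₃) R Z = 3 * R ^ 2 / 2 + 2 * d₂ + d₃ * (12 * R ^ 2 - 8 * Z ^ 2) := by
  rw [dRR_evenSextic (ψ := psiPCF d₁ d₂ d₃) (a := d₁) (b := d₂ - 4 * d₃ * Z ^ 2) (c := 1 / 8 + d₃)
    (e := 0) (fun r => by unfold psiPCF; ring)]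
  ring

/-- `∂²Ψ/∂Z²` of the PCF solution: `-8 d₃ R²`. [cite: PatakiCerfonFreidberg2013, §6.1] -/
theorem dZZ_psiPCF (d₁ d₂ d₃ R Z : ℝ) : dZZ (psiPCF d₁ d₂ d₃) R Z = -(8 * d₃ * R ^ 2) := by
  rw [dZZ_evenSextic (ψ := psiPCF d₁ d₂ d₃) (a := R ^ 4 / 8 + d₁ + d₂ * R ^ 2 + d₃ * R ^ 4)
    (b := -(4 * d₃ * R ^ 2)) (c := 0) (e := 0) (fun z => by unfold psiPCF; ring)]
  ring

/-- Midplane factorisation: the two midplane constraints `Ψ(1±ε,0) = 0` (`ε ≠ 0`) force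
`Ψ(R,0) = (1/8 + d₃)(R² - (1+ε)²)(R² - (1-ε)²)`. [cite: PatakiCerfonFreidberg2013, §6.1] -/
theorem psiPCF_midplane {ε d₁ d₂ d₃ : ℝ} (hε : ε ≠ 0) (h₁ : psiPCF d₁ d₂ d₃ (1 + ε) 0 = 0)
    (h₂ : psiPCF d₁ d₂ d₃ (1 - ε) 0 = 0) (R : ℝ) :
    psiPCF d₁ d₂ d₃ R 0 = (1 / 8 + d₃) * (R ^ 2 - (1 + ε) ^ 2) * (R ^ 2 - (1 - ε) ^ 2) := by
  unfold psiPCF at *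
  have hd₂ : d₂ = -(1 / 8 + d₃) * ((1 + ε) ^ 2 + (1 - ε) ^ 2) := by
    have h := sub_eq_zero.mpr (h₁.trans h₂.symm)
    have h' : 8 * ε * (d₂ + (1 / 8 + d₃) * ((1 + ε) ^ 2 + (1 - ε) ^ 2)) = 0 := by
      linear_combination 2 * h
    have h8 : (8 : ℝ) * ε ≠ 0 := mul_ne_zero (by norm_num) hε
    linear_combination (mul_eq_zero.mp h').resolve_left h8
  have hd₁ : d₁ = (1 / 8 + d₃) * (1 + ε) ^ 2 * (1 - ε) ^ 2 := by
    linear_combination h₁ - (1 + ε) ^ 2 * hd₂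
  rw [hd₁, hd₂]
  ring

/-- **The magnetic axis of a shape-fitted PCF equilibrium lies at `R_a² = 1 + ε²`, `Z_a = 0`**
(`∇Ψ = 0` there), independently of `κ, δ`. [cite: PatakiCerfonFreidberg2013, §6.1] -/
theorem psiPCF_axis {ε d₁ d₂ d₃ : ℝ} (hε : ε ≠ 0) (h₁ : psiPCF d₁ d₂ d₃ (1 + ε) 0 = 0)
    (h₂ : psiPCF d₁ d₂ d₃ (1 - ε) 0 = 0) {Ra : ℝ} (hRa : Ra ^ 2 = 1 + ε ^ 2) :
    IsCriticalPoint (psiPCF d₁ d₂ d₃) Ra 0 := by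
  have hd₂ : d₂ = -(1 / 8 + d₃) * ((1 + ε) ^ 2 + (1 - ε) ^ 2) := by
    unfold psiPCF at h₁ h₂
    have h := sub_eq_zero.mpr (h₁.trans h₂.symm)
    have h' : 8 * ε * (d₂ + (1 / 8 + d₃) * ((1 + ε) ^ 2 + (1 - ε) ^ 2)) = 0 := by
      linear_combination 2 * h
    have h8 : (8 : ℝ) * ε ≠ 0 := mul_ne_zero (by norm_num) hε
    linear_combination (mul_eq_zero.mp h').resolve_left h8
  refine ⟨?_, ?_⟩
  · rw [dR_psiPCF]
    have : Ra ^ 3 = Ra * (1 + ε ^ 2) := by rw [← hRa]; ring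
    rw [this, hd₂]
    ring
  · rw [dZ_psiPCF]; ring

/-- **Every flux surface of a PCF equilibrium is a graph over the midplane:** for `R ≠ 0`, `d₃ ≠ 0`,
`Ψ(R,Z) = c ↔ Z² = ((1/8 + d₃)R⁴ + d₂R² + d₁ - c)/(4 d₃ R²)`. [cite: PatakiCerfonFreidberg2013, §6.1] -/
theorem psiPCF_eq_iff_sq {d₁ d₂ d₃ R Z c : ℝ} (hR : R ≠ 0) (hd : d₃ ≠ 0) :
    psiPCF d₁ d₂ d₃ R Z = c ↔
      Z ^ 2 = ((1 / 8 + d₃) * R ^ 4 + d₂ * R ^ 2 + d₁ - c) / (4 * d₃ * R ^ 2) := by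
  have h4 : 4 * d₃ * R ^ 2 ≠ 0 := by positivity
  rw [eq_div_iff h4]
  unfold psiPCF
  constructor <;> intro h <;> linear_combination (-1 : ℝ) * h

/-- On-axis second derivatives of a PCF equilibrium at a midplane point `(R, 0)`:
`Ψ_RR = 3R²/2 + 2d₂ + 12d₃R²`, `Ψ_ZZ = -8d₃R²`, so `Ψ_RR Ψ_ZZ` and `κ₀² = Ψ_RR/Ψ_ZZ` are
RATIONAL in the data (Freidberg (6.42)). [cite: PatakiCerfonFreidberg2013, §6.1] -/
theorem psiPCF_axisHessian (d₁ d₂ d₃ R : ℝ) :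
    dRR (psiPCF d₁ d₂ d₃) R 0 = 3 * R ^ 2 / 2 + 2 * d₂ + 12 * d₃ * R ^ 2 ∧
      dZZ (psiPCF d₁ d₂ d₃) R 0 = -(8 * d₃ * R ^ 2) := by
  rw [dRR_psiPCF, dZZ_psiPCF]
  constructor <;> ring

/-! ## Jardin's Shafranov–Solov'ev solution (4.38) and its tokamak normalisation (4.39) -/

/-- Jardin's Shafranov–Solov'ev solution `Ψ = ½(c₂R₀² + c₀R²)Z² + ⅛(c₁ - c₀)(R² - R₀²)²`
(`c₀` arbitrary), eq. (4.38) p.104. [cite: Jardin2010, §4.4.2 eq. (4.38)] -/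
def psiJardin (c₀ c₁ c₂ R₀ : ℝ) (R Z : ℝ) : ℝ :=
  (1 / 2) * (c₂ * R₀ ^ 2 + c₀ * R ^ 2) * Z ^ 2 + (1 / 8) * (c₁ - c₀) * (R ^ 2 - R₀ ^ 2) ^ 2

/-- **(4.38) solves `Δ*Ψ = c₁R² + c₂R₀²`** for all `c₀` (at `R ≠ 0`); i.e. it is the Solov'ev solution
with `C = c₁ = -μ₀ dp/dΨ` and `A = c₂R₀² = -g dg/dΨ` (see the provenance note in the module
docstring about the printed `μ₀`). [cite: Jardin2010, §4.4.2 eq. (4.38)] -/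
theorem gsOperator_psiJardin (c₀ c₁ c₂ R₀ : ℝ) {R : ℝ} (Z : ℝ) (hR : R ≠ 0) :
    gsOperator (psiJardin c₀ c₁ c₂ R₀) R Z = c₁ * R ^ 2 + c₂ * R₀ ^ 2 := by
  rw [gsOperator_evenSextic (ψ := psiJardin c₀ c₁ c₂ R₀)
    (a := (1 / 2) * c₂ * R₀ ^ 2 * Z ^ 2 + (1 / 8) * (c₁ - c₀) * R₀ ^ 4)
    (b := (1 / 2) * c₀ * Z ^ 2 - (1 / 4) * (c₁ - c₀) * R₀ ^ 2) (c := (1 / 8) * (c₁ - c₀)) (e := 0)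
    (a' := (1 / 8) * (c₁ - c₀) * (R ^ 2 - R₀ ^ 2) ^ 2) (b' := (1 / 2) * (c₂ * R₀ ^ 2 + c₀ * R ^ 2))
    (c' := 0) (e' := 0) hR (fun r => by unfold psiJardin; ring) (fun z => by unfold psiJardin; ring)]
  ring

/-- Hence (4.38) is a Solov'ev solution with `A = c₂R₀²`, `C = c₁` on `{R ≠ 0}` (Freidberg (6.149)).
[cite: Jardin2010, §4.4.2 eq. (4.38)] -/
theorem isSolovevSolutionOn_psiJardin (c₀ c₁ c₂ R₀ : ℝ) :
    IsSolovevSolutionOn {x : ℝ × ℝ | x.1 ≠ 0} (psiJardin c₀ c₁ c₂ R₀) (c₂ * R₀ ^ 2) c₁ := by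
  intro R Z h
  rw [gsOperator_psiJardin c₀ c₁ c₂ R₀ Z h]
  ring

/-- Jardin's tokamak normalisation, eq. (4.39): `Ψ = (B₀/(2R₀²κ₀q₀))[R²Z² + (κ₀²/4)(R² - R₀²)²]`
with `R₀` the axis radius, `B₀` the toroidal field at `R₀`, `κ₀` the on-axis ellipticity, `q₀` the
on-axis safety factor. [cite: Jardin2010, §4.4.2 eq. (4.39)] -/
def psiTok (B₀ R₀ κ₀ q₀ : ℝ) (R Z : ℝ) : ℝ :=
  B₀ / (2 * R₀ ^ 2 * κ₀ * q₀) * (R ^ 2 * Z ^ 2 + κ₀ ^ 2 / 4 * (R ^ 2 - R₀ ^ 2) ^ 2)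

/-- The pressure of (4.39): `p(Ψ) = (B₀(κ₀² + 1)/(μ₀R₀²κ₀q₀))(Ψ_B - Ψ)` for `0 < Ψ < Ψ_B`.
[cite: Jardin2010, §4.4.2 eq. (4.39)] -/
def pressureTok (μ0 B₀ R₀ κ₀ q₀ ΨB : ℝ) (s : ℝ) : ℝ :=
  B₀ * (κ₀ ^ 2 + 1) / (μ0 * R₀ ^ 2 * κ₀ * q₀) * (ΨB - s)

/-- The free function of (4.39): `g = R₀B₀` (constant; Freidberg's `F`). [cite: Jardin2010, §4.4.2 eq. (4.39)] -/
def gTok (B₀ R₀ : ℝ) (_s : ℝ) : ℝ := R₀ * B₀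

/-- `Δ*` of (4.39): `Δ*Ψ = (B₀(κ₀²+1)/(R₀²κ₀q₀)) R²` at `R ≠ 0` (`R₀, κ₀, q₀ ≠ 0`).
[cite: Jardin2010, §4.4.2 eq. (4.39)] -/
theorem gsOperator_psiTok {B₀ R₀ κ₀ q₀ R : ℝ} (Z : ℝ) (hR : R ≠ 0) (hR₀ : R₀ ≠ 0)
    (hκ : κ₀ ≠ 0) (hq : q₀ ≠ 0) :
    gsOperator (psiTok B₀ R₀ κ₀ q₀) R Z = B₀ * (κ₀ ^ 2 + 1) / (R₀ ^ 2 * κ₀ * q₀) * R ^ 2 := by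
  set k := B₀ / (2 * R₀ ^ 2 * κ₀ * q₀) with hk
  rw [gsOperator_evenSextic (ψ := psiTok B₀ R₀ κ₀ q₀) (a := k * (κ₀ ^ 2 / 4) * R₀ ^ 4)
    (b := k * (Z ^ 2 - κ₀ ^ 2 / 2 * R₀ ^ 2)) (c := k * (κ₀ ^ 2 / 4)) (e := 0)
    (a' := k * (κ₀ ^ 2 / 4) * (R ^ 2 - R₀ ^ 2) ^ 2) (b' := k * R ^ 2) (c' := 0) (e' := 0) hR
    (fun r => by unfold psiTok; ring) (fun z => by unfold psiTok; ring)]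
  rw [hk]
  field_simp
  ring

/-- (4.39) has Solov'ev profiles with `A = 0` and `C = B₀(κ₀²+1)/(R₀²κ₀q₀)` (`μ₀ ≠ 0`).
[cite: Jardin2010, §4.4.2 eq. (4.39)] -/
theorem isSolovevProfile_tok {μ0 B₀ R₀ κ₀ q₀ : ℝ} (ΨB : ℝ) (hμ : μ0 ≠ 0) :
    IsSolovevProfile μ0 (pressureTok μ0 B₀ R₀ κ₀ q₀ ΨB) (gTok B₀ R₀) 0
      (B₀ * (κ₀ ^ 2 + 1) / (R₀ ^ 2 * κ₀ * q₀)) := by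
  intro s
  have hg : HasDerivAt (gTok B₀ R₀) 0 s := hasDerivAt_const s (R₀ * B₀)
  have hp : HasDerivAt (pressureTok μ0 B₀ R₀ κ₀ q₀ ΨB)
      (B₀ * (κ₀ ^ 2 + 1) / (μ0 * R₀ ^ 2 * κ₀ * q₀) * (0 - 1)) s :=
    ((hasDerivAt_const s ΨB).sub (hasDerivAt_id s)).const_mul _
  refine ⟨hg.differentiableAt, by rw [hg.deriv]; ring, ?_⟩
  rw [hp.deriv]
  field_simp
  ring

/-- **Jardin's triple (4.39) `(Ψ, p, g)` solves the full Grad–Shafranov equation (6.15)** on `{R ≠ 0}`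
(`μ₀, R₀, κ₀, q₀ ≠ 0`). [cite: Jardin2010, §4.4.2 eq. (4.39)] -/
theorem isGSSolutionOn_tok {μ0 B₀ R₀ κ₀ q₀ : ℝ} (ΨB : ℝ) (hμ : μ0 ≠ 0) (hR₀ : R₀ ≠ 0)
    (hκ : κ₀ ≠ 0) (hq : q₀ ≠ 0) :
    IsGSSolutionOn {x : ℝ × ℝ | x.1 ≠ 0} (psiTok B₀ R₀ κ₀ q₀) μ0
      (pressureTok μ0 B₀ R₀ κ₀ q₀ ΨB) (gTok B₀ R₀) := by
  rw [isGSSolutionOn_iff_solovev (isSolovevProfile_tok ΨB hμ)]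
  intro R Z h
  rw [gsOperator_psiTok Z h hR₀ hκ hq]
  ring

/-- The axis data of (4.39): `∇Ψ(R₀, 0) = 0`, `Ψ_RR(R₀,0) = B₀κ₀/q₀`, `Ψ_ZZ(R₀,0) = B₀/(κ₀q₀)`
(`R₀, κ₀, q₀ ≠ 0`). [cite: Jardin2010, §4.4.2 eq. (4.39)] -/
theorem psiTok_axis {B₀ R₀ κ₀ q₀ : ℝ} (hR₀ : R₀ ≠ 0) (hκ : κ₀ ≠ 0) (hq : q₀ ≠ 0) :
    IsCriticalPoint (psiTok B₀ R₀ κ₀ q₀) R₀ 0 ∧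
      dRR (psiTok B₀ R₀ κ₀ q₀) R₀ 0 = B₀ * κ₀ / q₀ ∧ dZZ (psiTok B₀ R₀ κ₀ q₀) R₀ 0 = B₀ / (κ₀ * q₀) := by
  set k := B₀ / (2 * R₀ ^ 2 * κ₀ * q₀) with hk
  have hRsl : ∀ r, psiTok B₀ R₀ κ₀ q₀ r 0
      = k * (κ₀ ^ 2 / 4) * R₀ ^ 4 + k * (0 ^ 2 - κ₀ ^ 2 / 2 * R₀ ^ 2) * r ^ 2
        + k * (κ₀ ^ 2 / 4) * r ^ 4 + 0 * r ^ 6 := fun r => by unfold psiTok; ring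
  have hZsl : ∀ z, psiTok B₀ R₀ κ₀ q₀ R₀ z
      = k * (κ₀ ^ 2 / 4) * (R₀ ^ 2 - R₀ ^ 2) ^ 2 + k * R₀ ^ 2 * z ^ 2 + 0 * z ^ 4 + 0 * z ^ 6 :=
    fun z => by unfold psiTok; ring
  refine ⟨⟨?_, ?_⟩, ?_, ?_⟩
  · rw [dR_evenSextic hRsl]; ring
  · rw [dZ_evenSextic hZsl]; ring
  · rw [dRR_evenSextic hRsl, hk]; field_simp; ring
  · rw [dZZ_evenSextic hZsl, hk]; field_simp; ring

/-- **For (4.39) Freidberg's on-axis safety factor (6.42) equals the parameter `q₀`** and the on-axis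
elongation² `Ψ_RR/Ψ_ZZ` equals `κ₀²` (`B₀, R₀, κ₀, q₀ > 0`): the printed identification of the
constants. [cite: Jardin2010, §4.4.2 eq. (4.39)] -/
theorem safetyFactorOnAxis_tok {B₀ R₀ κ₀ q₀ : ℝ} (hB : 0 < B₀) (hR₀ : 0 < R₀) (hκ : 0 < κ₀)
    (hq : 0 < q₀) :
    safetyFactorOnAxis (gTok B₀ R₀ 0) R₀ (dRR (psiTok B₀ R₀ κ₀ q₀) R₀ 0)
        (dZZ (psiTok B₀ R₀ κ₀ q₀) R₀ 0) = q₀ ∧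
      dRR (psiTok B₀ R₀ κ₀ q₀) R₀ 0 / dZZ (psiTok B₀ R₀ κ₀ q₀) R₀ 0 = κ₀ ^ 2 := by
  obtain ⟨-, hRR, hZZ⟩ := psiTok_axis (B₀ := B₀) hR₀.ne' hκ.ne' hq.ne'
  rw [hRR, hZZ]
  constructor
  · unfold safetyFactorOnAxis gTok
    have : B₀ * κ₀ / q₀ * (B₀ / (κ₀ * q₀)) = (B₀ / q₀) ^ 2 := by field_simp
    rw [this, Real.sqrt_sq (by positivity)]
    field_simp
  · field_simp

/-! ## Solov'ev's 1968 configuration as printed by Xu–Fitzpatrick (exact, cubic-free case) -/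

/-- The exact (cubic-free, `b = (1 - C)A`) member of Solov'ev's configuration, Xu–Fitzpatrick eq. (4):
`ψ = (A R₀²/2)(1 + C(r² - R₀²)/R₀²) z² + ((a - AC)/8)(r² - R₀²)²` with `-p' = a`,
`-I_A I_A' = bR₀²`, `b = (1 - C)A` (their §3 «first case» has `a = 6/5`, `C = 11`, `A = 1/10`,
`R₀ = 10`, `b = -1`). [cite: XuFitzpatrick2019, §2 eq. (4)] -/
def psiXF (A C a R₀ : ℝ) (r z : ℝ) : ℝ :=
  A * R₀ ^ 2 / 2 * (1 + C * (r ^ 2 - R₀ ^ 2) / R₀ ^ 2) * z ^ 2 + (a - A * C) / 8 * (r ^ 2 - R₀ ^ 2) ^ 2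

/-- The cubic-free Xu–Fitzpatrick/Solov'ev configuration solves `Δ*ψ = a r² + (1 - C) A R₀²`
(`= -r²p' - I_A I_A'` with `b = (1 - C)A`) at `r ≠ 0`, `R₀ ≠ 0`. [cite: XuFitzpatrick2019, §2 eq. (4)] -/
theorem gsOperator_psiXF (A C a : ℝ) {R₀ r : ℝ} (z : ℝ) (hr : r ≠ 0) (hR₀ : R₀ ≠ 0) :
    gsOperator (psiXF A C a R₀) r z = a * r ^ 2 + (1 - C) * A * R₀ ^ 2 := by
  rw [gsOperator_evenSextic (ψ := psiXF A C a R₀)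
    (a := A * R₀ ^ 2 / 2 * (1 - C) * z ^ 2 + (a - A * C) / 8 * R₀ ^ 4)
    (b := A * C / 2 * z ^ 2 - (a - A * C) / 4 * R₀ ^ 2) (c := (a - A * C) / 8) (e := 0)
    (a' := (a - A * C) / 8 * (r ^ 2 - R₀ ^ 2) ^ 2)
    (b' := A * R₀ ^ 2 / 2 * (1 + C * (r ^ 2 - R₀ ^ 2) / R₀ ^ 2)) (c' := 0) (e' := 0) hr
    (fun x => by unfold psiXF; field_simp; ring) (fun x => by unfold psiXF; ring)]
  field_simp
  ring

/-- Xu–Fitzpatrick's «first case» (§3): `a = 6/5`, `b = -5a/6 = -1`, `C = 11`, `A = a/12 = 1/10`,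
`R = 10`, i.e. `ψ = 5(1 + 11(r² - 100)/100) z² + (r² - 100)²/80`, solving `Δ*ψ = (6/5) r² - 100`.
[cite: XuFitzpatrick2019, §3] -/
theorem gsOperator_psiXF_case1 {r : ℝ} (z : ℝ) (hr : r ≠ 0) :
    psiXF (1 / 10) 11 (6 / 5) 10 r z = 5 * (1 + 11 * (r ^ 2 - 100) / 100) * z ^ 2 + (r ^ 2 - 100) ^ 2 / 80
      ∧ gsOperator (psiXF (1 / 10) 11 (6 / 5) 10) r z = 6 / 5 * r ^ 2 - 100 := by
  refine ⟨by unfold psiXF; ring, ?_⟩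
  rw [gsOperator_psiXF (1 / 10) 11 (6 / 5) z hr (by norm_num)]
  ring

end Literature.MathematicalPhysics.MHD.Solovev
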